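import Literature.NumberTheory.Transcendental.QuadraticRelationsLogarithmsSec5Basis
import HarnessLib

/-!
# Roy–Waldschmidt 1997, §5: the data of the proof of Théorème 5.1 (bases of `W` and `Y`, the box `Σ`)

D. Roy, M. Waldschmidt, Ann. Sci. ÉNS (4) 30 (1997) 753–796, proof of Théorème 5.1, p. 780–781:
"Fixons un tel choix de bases de `Y` et `Y_a` et choisissons aussi une base `{w₁, …, w_{ℓ₀}}` de
`W` en tant qu'espace vectoriel sur `K`. On pose `γ_j = exp_G(η_j)` pour `j = 1, …, ℓ₁`. …
`Σ = {γ₁^{s₁} ⋯ γ_{ℓ₁}^{s_{ℓ₁}} ; 0 ≤ s₁ ≤ S₁, …, 0 ≤ s_{ℓ₁} ≤ S_{ℓ₁}}`" and p. 782: "le sous-espace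
de `T_G(ℂ)` engendré par `w₁, …, w_{ℓ₀}` et `η₁, …, η_N` est de dimension `n` car il coïncide avec
celui engendré par `W` et `Y`."

PROVED here for an object `X = (d₀, d₁, W, Y, Y_a)`:

* `RWObj.exists_K_basis_W` — a `K`-basis `w : Fin ℓ₀ → T_G(ℂ)` of `W` (coordinates in `K`,
  `K`-independent, `K`-span `= W`, `ℂ`-span `= ℂW`);
* `span_boxFamily_eq` — for a `ℤ`-independent `η` with `∑ ℤηᵢ = Y` and box sizes `Sᵢ ≥ 1`, the
  `ℂ`-span of the box points `η_s = ∑ sᵢηᵢ` (`0 ≤ sᵢ ≤ Sᵢ`) is `ℂY`; hence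
  `dim span{w_j, η_s} = n(X)` (`finrank_span_w_box_eq_nn`);
* `exists_snd_ne_zero` — if `Y ⊄ ℂ^{d₀} × 0` some `ηᵢ` has `ηᵢ^{(d₀+·)} ≠ 0`.

No definitions (`boxFamily` is a body), no named facts.

## References

* [RoyWaldschmidt1997ENS] D. Roy, M. Waldschmidt, Ann. Sci. ÉNS (4) 30 (1997) 753–796, proof of
  Théorème 5.1, pp. 780–782.
-/

noncomputable section

open Complex IntermediateField Module Submodule

namespace Literature.NumberTheory.Transcendental

namespace RoyWaldschmidt1997

open LiePresentation

variable {K : IntermediateField ℚ ℂ}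

/-! ### A `K`-basis of `W` -/

namespace RWObj

/-- **A `K`-basis `w₁, …, w_{ℓ₀}` of `W`** (vectors of `K^d ⊆ ℂ^d`): coordinates in `K`,
`K`-linearly independent, `K`-span `W`, and `ℂ`-span `ℂW`.
[cite: RoyWaldschmidt1997ENS, proof of Théorème 5.1, p. 780] -/
theorem exists_K_basis_W (X : RWObj K) :
    ∃ w : Fin X.ell₀ → (Fin X.d₀ → ℂ) × (Fin X.d₁ → ℂ),
      (∀ j, (∀ i, (w j).1 i ∈ K) ∧ ∀ i, (w j).2 i ∈ K) ∧ LinearIndependent K w ∧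
      Submodule.span K (Set.range w) = X.W ∧
      Submodule.span ℂ (Set.range w) = Submodule.span ℂ (X.W : Set ((Fin X.d₀ → ℂ) × (Fin X.d₁ → ℂ))) := by
  haveI : Module.Finite K X.W := X.finite_W
  haveI : Module.Free K X.W := Module.Free.of_divisionRing K X.W
  let b : Basis (Fin X.ell₀) K X.W := Module.finBasis K X.W
  refine ⟨fun j => (b j : (Fin X.d₀ → ℂ) × (Fin X.d₁ → ℂ)), fun j => X.hW _ (b j).2, ?_, ?_, ?_⟩
  · exact b.linearIndependent.map' X.W.subtype (Submodule.ker_subtype _)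
  · have : Set.range (fun j => (b j : (Fin X.d₀ → ℂ) × (Fin X.d₁ → ℂ))) = X.W.subtype '' Set.range b := by
      rw [← Set.range_comp]; rfl
    rw [this, ← Submodule.map_span, b.span_eq, Submodule.map_top, Submodule.range_subtype]
  · apply le_antisymm
    · exact Submodule.span_mono (by rintro _ ⟨j, rfl⟩; exact (b j).2)
    · rw [Submodule.span_le]
      intro x hx
      -- `x ∈ W = span_K (b j)`, so `x` is in the `ℂ`-span
      have hxK : x ∈ Submodule.span K (Set.range fun j => (b j : (Fin X.d₀ → ℂ) × (Fin X.d₁ → ℂ))) := by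
        have : Set.range (fun j => (b j : (Fin X.d₀ → ℂ) × (Fin X.d₁ → ℂ))) = X.W.subtype '' Set.range b := by
          rw [← Set.range_comp]; rfl
        rw [this, ← Submodule.map_span, b.span_eq, Submodule.map_top, Submodule.range_subtype]
        exact hx
      have hle : Submodule.span K (Set.range fun j => (b j : (Fin X.d₀ → ℂ) × (Fin X.d₁ → ℂ))) ≤
          (Submodule.span ℂ (Set.range fun j => (b j : (Fin X.d₀ → ℂ) × (Fin X.d₁ → ℂ)))).restrictScalars K :=
        Submodule.span_le.mpr (fun y hy => Submodule.subset_span hy)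
      exact hle hxK

end RWObj

/-! ### The box `Σ` and its span -/

/-- The box point `η_s = ∑ᵢ sᵢ ηᵢ` for `s ∈ ∏ᵢ {0, …, Sᵢ}`. [cite: RoyWaldschmidt1997ENS, proof of Théorème 5.1, p. 781] -/
def boxFamily {ι : Type*} [Fintype ι] {V : Type*} [AddCommGroup V] (η : ι → V) (S : ι → ℕ)
    (s : ∀ i, Fin (S i + 1)) : V :=
  ∑ i, ((s i : ℕ) : ℤ) • η i

/-- Unfolding `boxFamily`. [folklore] -/
theorem boxFamily_apply {ι : Type*} [Fintype ι] {V : Type*} [AddCommGroup V] (η : ι → V) (S : ι → ℕ)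
    (s : ∀ i, Fin (S i + 1)) : boxFamily η S s = ∑ i, ((s i : ℕ) : ℤ) • η i := rfl

/-- The unit index `e_i` of the box (needs `S_i ≥ 1`): `η_{e_i} = η_i`. [folklore] -/
theorem boxFamily_single {ι : Type*} [Fintype ι] [DecidableEq ι] {V : Type*} [AddCommGroup V] (η : ι → V)
    (S : ι → ℕ) (hS : ∀ i, 1 ≤ S i) (i : ι) :
    boxFamily η S (fun k => if k = i then ⟨1, by have := hS k; omega⟩ else 0) = η i := by
  rw [boxFamily_apply, Finset.sum_eq_single i]
  · simp
  · intro k _ hki; simp [hki]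
  · intro h; exact absurd (Finset.mem_univ i) h

/-- The zero index of the box: `η_0 = 0`. [folklore] -/
theorem boxFamily_zero {ι : Type*} [Fintype ι] {V : Type*} [AddCommGroup V] (η : ι → V) (S : ι → ℕ) :
    boxFamily η S (fun _ => 0) = 0 := by
  rw [boxFamily_apply]; simp

/-- **The `ℂ`-span of the box points is the `ℂ`-span of the `ηᵢ`** (box sizes `≥ 1`).
[cite: RoyWaldschmidt1997ENS, proof of Théorème 5.1, p. 782] -/
theorem span_boxFamily_eq {ι : Type*} [Fintype ι] [DecidableEq ι] {d₀ d₁ : ℕ}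
    (η : ι → (Fin d₀ → ℂ) × (Fin d₁ → ℂ)) (S : ι → ℕ) (hS : ∀ i, 1 ≤ S i) :
    Submodule.span ℂ (Set.range (boxFamily η S)) = Submodule.span ℂ (Set.range η) := by
  apply le_antisymm
  · rw [Submodule.span_le]
    rintro _ ⟨s, rfl⟩
    rw [boxFamily_apply]
    refine Submodule.sum_mem _ fun i _ => ?_
    rw [← Int.cast_smul_eq_zsmul ℂ]
    exact Submodule.smul_mem _ _ (Submodule.subset_span ⟨i, rfl⟩)
  · rw [Submodule.span_le]
    rintro _ ⟨i, rfl⟩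
    rw [← boxFamily_single η S hS i]
    exact Submodule.subset_span ⟨_, rfl⟩

/-- `ℂ`-span of a `ℤ`-spanning family: if `∑ ℤηᵢ = Y` then `span_ℂ{ηᵢ} = ℂY`. [folklore] -/
theorem span_range_eq_span_of_span_int {ι : Type*} {d₀ d₁ : ℕ} (η : ι → (Fin d₀ → ℂ) × (Fin d₁ → ℂ))
    (Y : Submodule ℤ ((Fin d₀ → ℂ) × (Fin d₁ → ℂ))) (hY : Submodule.span ℤ (Set.range η) = Y) :
    Submodule.span ℂ (Set.range η) = Submodule.span ℂ (Y : Set ((Fin d₀ → ℂ) × (Fin d₁ → ℂ))) := by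
  rw [← hY, Submodule.span_span_of_tower]

/-- **`dim span{w_j, η_s} = n(X)`**: with `w` a `K`-basis of `W` and `η_s` the box on a `ℤ`-basis of
`Y`, the span of all these vectors is `ℂW + ℂY`. [cite: RoyWaldschmidt1997ENS, proof of Théorème 5.1, p. 782] -/
theorem finrank_span_w_box_eq_nn (X : RWObj K) {ℓ : ℕ} (w : Fin ℓ → (Fin X.d₀ → ℂ) × (Fin X.d₁ → ℂ))
    (hw : Submodule.span ℂ (Set.range w) = Submodule.span ℂ (X.W : Set ((Fin X.d₀ → ℂ) × (Fin X.d₁ → ℂ))))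
    {ι : Type*} [Fintype ι] [DecidableEq ι] (η : ι → (Fin X.d₀ → ℂ) × (Fin X.d₁ → ℂ))
    (hη : Submodule.span ℤ (Set.range η) = X.Y) (S : ι → ℕ) (hS : ∀ i, 1 ≤ S i) :
    Module.finrank ℂ ↥(Submodule.span ℂ (Set.range w ∪ Set.range (boxFamily η S))) = X.nn := by
  rw [RWObj.nn, Submodule.span_union, Submodule.span_union, hw, span_boxFamily_eq η S hS,
    span_range_eq_span_of_span_int η X.Y hη]

/-- **If `Y ⊄ ℂ^{d₀} × 0`, some basis vector `ηᵢ` has non-zero `𝔾ₘ`-part.** [folklore] -/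
theorem exists_snd_ne_zero {ι : Type*} {d₀ d₁ : ℕ} (η : ι → (Fin d₀ → ℂ) × (Fin d₁ → ℂ))
    (Y : Submodule ℤ ((Fin d₀ → ℂ) × (Fin d₁ → ℂ))) (hY : Submodule.span ℤ (Set.range η) = Y)
    (h : ∃ y ∈ Y, y.2 ≠ 0) : ∃ i, (η i).2 ≠ 0 := by
  by_contra hall
  push Not at hall
  obtain ⟨y, hy, hy2⟩ := h
  apply hy2
  rw [← hY] at hy
  -- the second projection vanishes on the span
  have : ∀ z ∈ Submodule.span ℤ (Set.range η), z.2 = 0 := by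
    intro z hz
    induction hz using Submodule.span_induction with
    | mem x hx => obtain ⟨i, rfl⟩ := hx; exact hall i
    | zero => rfl
    | add a b _ _ ha hb => simp [ha, hb]
    | smul c a _ ha => simp [ha]
  exact this y hy

end RoyWaldschmidt1997

end Literature.NumberTheory.Transcendental
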